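import Summits.RiemannHypothesis.RiemannHypothesis.Theorems.SoloInformedQuasiWeilSobolev

/-!
# The exact thermometer: the negativity rate of Weil's functional on windows IS the width of the zero-strip

Solo programme `solo-RiemannHypothesis-informed`, session 2. Everything here is proved
(no named facts are introduced; the inputs are the tree's explicit formula
`explicit_formula_holds`, the zero-side machinery of `WeilCriterionConverse.lean`, the
Laplace-transform lemma `BoundedPowerSum.sum_fiber_eq_zero_of_exp`, Plancherel on the critical
line `integral_norm_sq_weilMellin_half_line`, Gallagher's unit-cell inequality and Jensen's local
zero count `exists_sum_zetaZeroWindow_le`).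

## The theorems

Let `Q(g) = W(g ⋆ g̃) = ∑_ρ m(ρ) ĝ(ρ) conj ĝ(1 - ρ̄)` be Weil's quadratic functional (Bombieri 2000
§4, Yoshida 1992), `ε(a) = weilGroundEnergy a` its ground energy on the `L²`-unit sphere of the
smooth functions supported in `[-a, a]`, and `N(g) = ‖g‖₂² + ‖g'‖₂²` the Sobolev mass. Yoshida's
criterion (tree: `riemannHypothesis_iff_forall_weilPositivityOn`) reads `RH ↔ ∀ a > 0, ε(a) ≥ 0`.
Write `Θ_ζ = sup_ρ |2 Re ρ - 1| ∈ [0, 1]` for the width of the set of non-trivial zeros.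

**Main theorem** (`width_iff_weilQuadratic_sobolev_subexp`). For every `Θ ≥ 0`,

  `(∀ ρ, |Re ρ - 1/2| ≤ Θ/2) ↔ ∀ κ > Θ, ∃ C, ∀ a > 0, ∀ g ∈ C_c^∞[-a, a], Re Q(g) ≥ -C e^{κ a} N(g)`,

unconditionally and with no hypothesis on the vertical distribution of the zeros. In words:
**the exponential rate of negativity of the Sobolev-normalised Weil functional on the window
`[-a, a]`, `η_N = limsup_a (1/a) log⁺ sup_g (-Re Q(g)/N(g))`, equals the width `Θ_ζ`** — the
Weil-functional counterpart of `sup Re ρ = inf {θ : ψ(x) - x ≪ x^{θ+ε}}`. The case `Θ = 0` is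
`riemannHypothesis_iff_weilQuadratic_sobolev_subexp` /
`summit_iff_weilQuadratic_sobolev_subexp`: **RH ↔ ∀ κ > 0, ∃ C, ∀ a > 0, ∀ g, Re Q(g) ≥ -C e^{κa} N(g)**,
and every value of `η_N` strictly below the trivial `1` is a quasi-Riemann hypothesis.

The two halves, with the intermediate statements (all kernel-checked here):

* (lower half, `η ≥ Θ_ζ`, any dipole-bounded normalisation)
  `abs_re_sub_half_le_of_weilGroundEnergy_exp_lower`: if `ε(a) ≥ -C e^{κ a}` for all large `a`
  (`κ ≥ 0`) then every non-trivial zero has `|Re ρ - 1/2| ≤ κ/2`; the same with `Re Q(g) ≥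
  -C e^{κa} ‖g‖₂²` (`…_of_weilQuadratic_exp_lower`), with `Re Q(g) ≥ -C e^{κa} N(g)`
  (`…_of_weilQuadratic_sobolev_exp_lower`), and with ANY mass functional bounded along dipole
  families (`abs_re_sub_half_le_of_zeroForm_slack`); `Ω`-forms
  `frequently_weilGroundEnergy_lt_of_offline_zero`,
  `exists_frequently_weilGroundEnergy_lt_of_not_riemannHypothesis`; and the `L²` criterion
  `riemannHypothesis_iff_weilGroundEnergy_subexp`: `RH ↔ ∀ κ > 0, ∃ C, ∀ a > 0, ε(a) ≥ -C e^{κ a}`.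
* (upper half, `η_N ≤ Θ_ζ`) `zeroForm_re_ge_sobolev_of_width` /
  `weilQuadratic_re_ge_sobolev_of_width`: if `|Re ρ - 1/2| ≤ Θ/2` for all zeros then
  `Re Q(g) ≥ -C (1 + a)³ e^{Θ a} N(g)` for every test `g` supported in `[-a, a]`.
* (the `L²` normalisation) the trivial floor `weilGroundEnergy_ge_neg_exp`: `ε(a) ≥ -C(1+a)e^{a}`
  (`κ = 1`, from Bombieri's a-priori bound and `∑_{n ≤ x} Λ(n)/√n ≤ 4 √x log x`); exactness when
  the exceptional set is finite (`weilGroundEnergy_ge_of_finite_offline`: `ε(a) ≥ -C a e^{Θ a}`) or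
  vertically sparse (`weilGroundEnergy_ge_of_sparse_offline`: bounded local count `d` of off-line
  zeros gives `ε(a) ≥ -C(1+a)³ e^{Θ a}`). In the `L²` normalisation the rate `η` can exceed `Θ_ζ`
  only through unbounded vertical clustering of off-line zeros (test functions focusing `ĝ` on a
  cluster); the Sobolev normalisation prices this out, which is why the main theorem needs no
  density hypothesis.

## Proofs

*Lower half.* Bombieri's translation–polarisation argument (tree: `zeroForm_translateMix`,
`norm_expSum_le`) run with slack and with a *centred* pair of translates. For a test `g` supported
in `[-b, b]` and `x ≥ 0` put `g₁ = g(· + x/2)`; the dipole `g₁ + c·g₁(· - x)` is supported in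
`[-(b + x/2), b + x/2]`, has mass `≤ 4×` that of `g` for `|c| = 1` (in `L²`, in `N`, in any
translation-invariant seminorm), and its zero-side form is `2 Re Q(g) + 2 Re(c B_g(x))` where
`B_g(x) = ∑_ρ m(ρ) ĝ(ρ) conj ĝ(1-ρ̄) e^{(ρ-1/2)x}`. Choosing the phase `c` against `B_g(x)`, the
slack hypothesis gives `|B_g(x)| ≤ M_g e^{(κ/2) x}`; the generalised Dirichlet series `B_g` over
the zeros then has no exponent of real part `> κ/2` (`sum_fiber_eq_zero_of_exp_growth`), while
for a zero `ρ₀` with `Re ρ₀ - 1/2 > κ/2` a narrow bump has `m(ρ₀) ĝ(ρ₀) conj ĝ(1 - ρ̄₀) ≠ 0`.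
The reflection `ρ ↦ 1 - ρ̄` gives the other side.

*Upper half.* On the zero side only off-line zeros contribute negatively, by at most
`∑_off m |ĝ(ρ)||ĝ(1-ρ̄)| ≤ ½ ∑_off m (|ĝ(ρ)|² + |ĝ(1-ρ̄)|²)`. For a sample point `1/2 + β + iγ`
with `|β| ≤ Θ/2`, a ONE-SIDED Sobolev cell in `σ` of length `Θ/2` towards the critical line
(`norm_sq_weilMellin_le_integral_sigma`) bounds `|ĝ(1/2+β+iγ)|²` by `σ`-integrals over
`|σ| ≤ Θ/2` of `|ĝ|²` and `|ĝ||(xg)^|` on the line `Re = 1/2 + σ`; there `ĝ(1/2+σ+it)` is the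
critical-line transform of the tilt `g e^{σx}`, of `L²`-mass `≤ e^{Θ a}‖g‖₂²`
(`weilNorm2Sq_mul_cexp_real_le`). Summing over sample points with weights of bounded local count
and applying Gallagher's unit cell + Plancherel on the critical line
(`sum_mul_norm_sq_weilMellin_line_le_of_localCount`) gives the strip lemma
`sum_mul_norm_sq_weilMellin_strip_le`: `∑ w_i |ĝ(1/2+β_i+iγ_i)|² ≤ 2πd(1+Θa)(3+a²)e^{Θa}‖g‖₂²`.
Finally the weights `w_ρ = m(ρ)/(1+γ²)` have bounded local count unconditionally
(`exists_weighted_localCount`, from Jensen's `N(t+½) - N(t-½) ≪ log(|t|+2)` and the reflection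
`m(1-ρ̄) = m(ρ)`), and `(1+γ²)|ĝ(ρ)|² ≤ |ĝ(ρ)|² + |(g')^(ρ)|²` (integration by parts,
`weilMellin_deriv`), so the strip lemma applied to `g` and `g'` bounds the negative part by
`C(1+a)³e^{Θa}(‖g‖₂² + ‖g'‖₂²)`.

## References

* E. Bombieri, *Remarks on Weil's quadratic functional in the theory of prime numbers I*,
  Rend. Mat. Acc. Lincei (9) 11 (2000), 183–233, Thm. 1 (proof pp. 189–190), §4.
* H. Yoshida, *On Hermitian forms attached to zeta functions*, Adv. Stud. Pure Math. 21 (1992),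
  281–325.
* P. X. Gallagher, *A large sieve density estimate near σ = 1*, Invent. Math. 11 (1970), 329–339
  (the unit-cell inequality, Lemma 1).
* H. L. Montgomery, R. C. Vaughan, *Multiplicative Number Theory I*, CUP 2007, Thm. 10.13
  (local zero count).
* A. Weil, *Sur les "formules explicites" de la théorie des nombres premiers*, Comm. Sém. Math.
  Univ. Lund (1952), 252–265.
-/

noncomputable section

open Complex Filter Set MeasureTheory
open scoped Real Topology ComplexConjugate ArithmeticFunction.vonMangoldt

namespace Summit.RiemannHypothesis.RiemannHypothesis.Theorems

open Literature.NumberTheory.LFunctions Literature.NumberTheory.LFunctions.WeilConverse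

/-! ### The Sobolev normalisation `‖φ‖₂² + ‖φ'‖₂²` -/

/-- Derivative of a translate. [folklore] -/
theorem deriv_weilTranslate (g : ℝ → ℂ) (y : ℝ) :
    deriv (weilTranslate g y) = weilTranslate (deriv g) y := by
  funext t
  show deriv (fun t ↦ g (t - y)) t = deriv g (t - y)
  exact deriv_comp_sub_const (f := g) (a := y) (x := t)

/-- Derivative of a dipole. [folklore] -/
theorem hasDerivAt_translateMix {g : ℝ → ℂ} (hg : IsWeilTest g) (c : ℂ) (x t : ℝ) :
    HasDerivAt (translateMix g c x) (translateMix (deriv g) c x t) t := by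
  have hd : Differentiable ℝ g := hg.1.differentiable (by simp)
  have h1 : HasDerivAt g (deriv g t) t := (hd t).hasDerivAt
  have h2 : HasDerivAt (fun t ↦ g (t - x)) (deriv g (t - x)) t :=
    HasDerivAt.comp_sub_const t x (hd _).hasDerivAt
  exact h1.add (h2.const_mul c)

/-- `(g + c g_x)' = g' + c (g')_x`. [folklore] -/
theorem deriv_translateMix {g : ℝ → ℂ} (hg : IsWeilTest g) (c : ℂ) (x : ℝ) :
    deriv (translateMix g c x) = translateMix (deriv g) c x :=
  funext fun t ↦ (hasDerivAt_translateMix hg c x t).deriv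

/-- The Sobolev mass is bounded along dipole families:
`‖D‖₂² + ‖D'‖₂² ≤ 4 (‖g‖₂² + ‖g'‖₂²)` for `D = g₁ + c g₁(· - x)`, `g₁ = g(· + x/2)`, `|c| = 1`.
[folklore] -/
theorem sobolev_translateMix_le {g : ℝ → ℂ} (hg : IsWeilTest g) {c : ℂ} (hc : ‖c‖ = 1) (x : ℝ) :
    (∫ t : ℝ, ‖translateMix (weilTranslate g (-(x / 2))) c x t‖ ^ 2) +
        ∫ t : ℝ, ‖deriv (translateMix (weilTranslate g (-(x / 2))) c x) t‖ ^ 2 ≤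
      4 * ((∫ t : ℝ, ‖g t‖ ^ 2) + ∫ t : ℝ, ‖deriv g t‖ ^ 2) := by
  have hg₁ : IsWeilTest (weilTranslate g (-(x / 2))) := hg.weilTranslate _
  have h1 := integral_norm_sq_translateMix_le hg₁ hc x
  rw [integral_norm_sq_weilTranslate] at h1
  have h2 := integral_norm_sq_translateMix_le hg₁.deriv hc x
  rw [deriv_weilTranslate, integral_norm_sq_weilTranslate] at h2
  rw [deriv_translateMix hg₁, deriv_weilTranslate]
  linarith

/-- **The Sobolev thermometer, zero-side form.** If for all `a ≥ a₀` and all test `φ` supported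
in `[-a, a]`, `Re Q(φ) ≥ -C e^{κ a} (‖φ‖₂² + ‖φ'‖₂²)` (`κ ≥ 0`), then every non-trivial zero has
`|Re ρ - 1/2| ≤ κ/2`. [folklore] -/
theorem abs_re_sub_half_le_of_zeroForm_sobolev_exp_lower {κ C a₀ : ℝ} (hκ : 0 ≤ κ)
    (H : ∀ a : ℝ, a₀ ≤ a → ∀ φ : ℝ → ℂ, IsWeilTest φ → tsupport φ ⊆ Icc (-a) a →
      -(C * Real.exp (κ * a)) * ((∫ t : ℝ, ‖φ t‖ ^ 2) + ∫ t : ℝ, ‖deriv φ t‖ ^ 2) ≤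
        (zeroForm φ).re)
    {ρ : ℂ} (hρ : ρ ∈ ZetaZeros.riemannZetaNontrivialZeros) : |ρ.re - 1 / 2| ≤ κ / 2 := by
  refine abs_re_sub_half_le_of_zeroForm_slack
    (Nf := fun φ ↦ (∫ t : ℝ, ‖φ t‖ ^ 2) + ∫ t : ℝ, ‖deriv φ t‖ ^ 2) hκ H (fun g hg ↦ ?_) hρ
  refine ⟨4 * ((∫ t : ℝ, ‖g t‖ ^ 2) + ∫ t : ℝ, ‖deriv g t‖ ^ 2), fun c x hc _ ↦ ?_⟩
  rw [abs_of_nonneg (add_nonneg (integral_nonneg fun _ ↦ by positivity)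
    (integral_nonneg fun _ ↦ by positivity))]
  exact sobolev_translateMix_le hg hc x

/-- **The Sobolev thermometer for Weil's functional.** If for all `a ≥ a₀` and all test `g`
supported in `[-a, a]`, `Re W(g ⋆ g̃) ≥ -C e^{κ a} (‖g‖₂² + ‖g'‖₂²)` (`κ ≥ 0`), then
`ζ` has no zeros with `|Re s - 1/2| > κ/2`. [folklore] -/
theorem abs_re_sub_half_le_of_weilQuadratic_sobolev_exp_lower {κ C a₀ : ℝ} (hκ : 0 ≤ κ)
    (H : ∀ a : ℝ, a₀ ≤ a → ∀ g : ℝ → ℂ, IsWeilTest g → tsupport g ⊆ Icc (-a) a →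
      -(C * Real.exp (κ * a)) * ((∫ t : ℝ, ‖g t‖ ^ 2) + ∫ t : ℝ, ‖deriv g t‖ ^ 2) ≤
        (weilQuadratic g).re)
    {ρ : ℂ} (hρ : ρ ∈ ZetaZeros.riemannZetaNontrivialZeros) : |ρ.re - 1 / 2| ≤ κ / 2 :=
  abs_re_sub_half_le_of_zeroForm_sobolev_exp_lower hκ
    (fun a ha g hg hs ↦ by rw [combShapeDetection_zeroForm_eq_weilQuadratic hg]; exact H a ha g hg hs) hρ

/-! ## The exact thermometer in the Sobolev normalisation -/

/-- `1 + a ≤ (1 + 1/δ) e^{δ a}` for `δ > 0`, `a ≥ 0`. [folklore] -/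
theorem one_add_le_mul_exp {δ : ℝ} (hδ : 0 < δ) {a : ℝ} (ha : 0 ≤ a) :
    1 + a ≤ (1 + 1 / δ) * Real.exp (δ * a) := by
  have hlin : δ * a + 1 ≤ Real.exp (δ * a) := Real.add_one_le_exp _
  have hpos : 0 ≤ 1 + 1 / δ := by positivity
  have hda : 0 ≤ δ * a := by positivity
  have hinv : 0 ≤ 1 / δ := by positivity
  calc 1 + a ≤ (1 + 1 / δ) * (δ * a + 1) := by
        have e : (1 + 1 / δ) * (δ * a + 1) = 1 + a + δ * a + 1 / δ := by
          field_simp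
          ring
        rw [e]
        linarith
    _ ≤ (1 + 1 / δ) * Real.exp (δ * a) := mul_le_mul_of_nonneg_left hlin hpos

/-- `(1 + a)³ ≤ (1 + 3/δ)³ e^{δ a}` for `δ > 0`, `a ≥ 0`. [folklore] -/
theorem one_add_pow_three_le_mul_exp {δ : ℝ} (hδ : 0 < δ) {a : ℝ} (ha : 0 ≤ a) :
    (1 + a) ^ 3 ≤ (1 + 1 / (δ / 3)) ^ 3 * Real.exp (δ * a) := by
  have h := one_add_le_mul_exp (δ := δ / 3) (by positivity) ha
  have h0 : 0 ≤ 1 + a := by linarith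
  calc (1 + a) ^ 3 ≤ ((1 + 1 / (δ / 3)) * Real.exp (δ / 3 * a)) ^ 3 := pow_le_pow_left₀ h0 h 3
    _ = (1 + 1 / (δ / 3)) ^ 3 * Real.exp (δ * a) := by
        rw [mul_pow, ← Real.exp_nat_mul]
        congr 2
        push_cast
        ring

/-- Sobolev-normalised quasi-positivity of Weil's functional at the rate of the width
(`zeroForm_re_ge_sobolev_of_width` through the explicit formula `Q(g) = W(g ⋆ g̃)`). [folklore] -/
theorem weilQuadratic_re_ge_sobolev_of_width {Θ : ℝ}
    (hΘ : ∀ ρ ∈ ZetaZeros.riemannZetaNontrivialZeros, |ρ.re - 1 / 2| ≤ Θ / 2) :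
    ∃ C : ℝ, 0 ≤ C ∧ ∀ a : ℝ, 0 < a → ∀ g : ℝ → ℂ, IsWeilTest g → tsupport g ⊆ Icc (-a) a →
      -(C * (1 + a) ^ 3 * Real.exp (Θ * a)) * (weilNorm2Sq g + weilNorm2Sq (deriv g)) ≤
        (weilQuadratic g).re := by
  obtain ⟨C, hC, h⟩ := zeroForm_re_ge_sobolev_of_width hΘ
  exact ⟨C, hC, fun a ha g hg hs ↦ by rw [← combShapeDetection_zeroForm_eq_weilQuadratic hg]; exact h a ha g hg hs⟩

/-- **Exact thermometer, upper half**: if every non-trivial zero has `|Re ρ − 1/2| ≤ Θ/2`, then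
for every `κ > Θ` there is `C` with `Re W(g⋆g̃) ≥ −C e^{κa}(‖g‖₂² + ‖g'‖₂²)` for all `a > 0`
and all test `g` supported in `[-a, a]`. [folklore] -/
theorem weilQuadratic_sobolev_exp_lower_of_width {Θ κ : ℝ}
    (hΘ : ∀ ρ ∈ ZetaZeros.riemannZetaNontrivialZeros, |ρ.re - 1 / 2| ≤ Θ / 2) (hκ : Θ < κ) :
    ∃ C : ℝ, ∀ a : ℝ, 0 < a → ∀ g : ℝ → ℂ, IsWeilTest g → tsupport g ⊆ Icc (-a) a →
      -(C * Real.exp (κ * a)) * (weilNorm2Sq g + weilNorm2Sq (deriv g)) ≤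
        (weilQuadratic g).re := by
  obtain ⟨C, hC0, hC⟩ := weilQuadratic_re_ge_sobolev_of_width hΘ
  have hδ : 0 < κ - Θ := sub_pos.2 hκ
  set M : ℝ := (1 + 1 / ((κ - Θ) / 3)) ^ 3 with hM
  have hM0 : 0 ≤ M := by positivity
  refine ⟨C * M, fun a ha g hg hs ↦ le_trans ?_ (hC a ha g hg hs)⟩
  have hN : 0 ≤ weilNorm2Sq g + weilNorm2Sq (deriv g) :=
    add_nonneg (integral_nonneg fun _ ↦ by positivity) (integral_nonneg fun _ ↦ by positivity)
  have h1 : (1 + a) ^ 3 * Real.exp (Θ * a) ≤ M * Real.exp (κ * a) := by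
    calc (1 + a) ^ 3 * Real.exp (Θ * a) ≤ (M * Real.exp ((κ - Θ) * a)) * Real.exp (Θ * a) :=
          mul_le_mul_of_nonneg_right (one_add_pow_three_le_mul_exp hδ ha.le) (Real.exp_pos _).le
      _ = M * Real.exp (κ * a) := by
          rw [mul_assoc, ← Real.exp_add]
          congr 2
          ring
  rw [neg_mul, neg_mul, neg_le_neg_iff]
  calc C * (1 + a) ^ 3 * Real.exp (Θ * a) * (weilNorm2Sq g + weilNorm2Sq (deriv g))
      = C * ((1 + a) ^ 3 * Real.exp (Θ * a)) * (weilNorm2Sq g + weilNorm2Sq (deriv g)) := by ring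
    _ ≤ C * (M * Real.exp (κ * a)) * (weilNorm2Sq g + weilNorm2Sq (deriv g)) := by gcongr
    _ = C * M * Real.exp (κ * a) * (weilNorm2Sq g + weilNorm2Sq (deriv g)) := by ring

/-- **The exact thermometer (Sobolev normalisation).** For `Θ ≥ 0` the following are
equivalent: (i) every non-trivial zero of `ζ` has `|Re ρ − 1/2| ≤ Θ/2`; (ii) for every `κ > Θ`
there is `C` with `Re W(g⋆g̃) ≥ −C e^{κa}(‖g‖₂² + ‖g'‖₂²)` for all `a > 0` and all test `g`
supported in `[-a, a]`. No hypothesis on the vertical distribution of the zeros is needed: the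
exponential rate of negativity of the Sobolev-normalised Weil functional on windows IS the width
`sup |2 Re ρ − 1|` of the set of zeros — the Weil-functional counterpart of the classical
`sup Re ρ = inf {θ : ψ(x) − x = O(x^{θ+ε})}`. `Θ = 0` is the Riemann hypothesis
(`riemannHypothesis_iff_weilQuadratic_sobolev_subexp`). [folklore] -/
theorem width_iff_weilQuadratic_sobolev_subexp {Θ : ℝ} (hΘ0 : 0 ≤ Θ) :
    (∀ ρ ∈ ZetaZeros.riemannZetaNontrivialZeros, |ρ.re - 1 / 2| ≤ Θ / 2) ↔
      ∀ κ : ℝ, Θ < κ → ∃ C : ℝ, ∀ a : ℝ, 0 < a → ∀ g : ℝ → ℂ, IsWeilTest g →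
        tsupport g ⊆ Icc (-a) a →
          -(C * Real.exp (κ * a)) * (weilNorm2Sq g + weilNorm2Sq (deriv g)) ≤
            (weilQuadratic g).re := by
  constructor
  · exact fun h κ hκ ↦ weilQuadratic_sobolev_exp_lower_of_width h hκ
  · intro h ρ hρ
    refine le_of_forall_pos_le_add fun ε hε ↦ ?_
    obtain ⟨C, hC⟩ := h (Θ + 2 * ε) (by linarith)
    have := abs_re_sub_half_le_of_weilQuadratic_sobolev_exp_lower (κ := Θ + 2 * ε) (C := C)
      (a₀ := 1) (by linarith) (fun a ha g hg hs ↦ hC a (by linarith) g hg hs) hρ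
    linarith

/-- **RH ⟺ sub-exponential Sobolev quasi-positivity of Weil's functional**:
`RH ↔ ∀ κ > 0, ∃ C, ∀ a > 0, ∀ g test on [-a, a], Re W(g⋆g̃) ≥ −C e^{κa}(‖g‖₂² + ‖g'‖₂²)`.
[folklore] -/
theorem riemannHypothesis_iff_weilQuadratic_sobolev_subexp :
    RiemannHypothesis ↔
      ∀ κ : ℝ, 0 < κ → ∃ C : ℝ, ∀ a : ℝ, 0 < a → ∀ g : ℝ → ℂ, IsWeilTest g →
        tsupport g ⊆ Icc (-a) a →
          -(C * Real.exp (κ * a)) * (weilNorm2Sq g + weilNorm2Sq (deriv g)) ≤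
            (weilQuadratic g).re := by
  have key := width_iff_weilQuadratic_sobolev_subexp (Θ := 0) le_rfl
  simp only [zero_div] at key
  rw [← key]
  constructor
  · intro hRH ρ hρ
    have h := ZetaZeros.riemannZetaNontrivialZeros.mem_iff'.1 hρ
    have := riemannHypothesis_iff_strip_holds.1 hRH ρ h.1 h.2.1 h.2.2
    rw [this, sub_self, abs_zero]
  · intro h
    refine riemannHypothesis_iff_strip_holds.2 fun s hs h0 h1 ↦ ?_
    have hρ := ZetaZeros.riemannZetaNontrivialZeros.mem_iff'.2 ⟨hs, h0, h1⟩
    have := abs_nonpos_iff.1 (h s hρ)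
    linarith

/-- Summit form of the exact thermometer at `Θ = 0`. [folklore] -/
theorem summit_iff_weilQuadratic_sobolev_subexp :
    Summit.RiemannHypothesis ↔
      ∀ κ : ℝ, 0 < κ → ∃ C : ℝ, ∀ a : ℝ, 0 < a → ∀ g : ℝ → ℂ, IsWeilTest g →
        tsupport g ⊆ Icc (-a) a →
          -(C * Real.exp (κ * a)) * (weilNorm2Sq g + weilNorm2Sq (deriv g)) ≤
            (weilQuadratic g).re :=
  riemannHypothesis_iff_weilQuadratic_sobolev_subexp

/-! ## Summit forms -/

/-- The summit `Summit.RiemannHypothesis` from sub-exponential quasi-positivity of the ground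
energy of Weil's functional. [folklore] -/
theorem summit_of_weilGroundEnergy_subexp
    (H : ∀ κ : ℝ, 0 < κ → ∃ C a₀ : ℝ, ∀ a : ℝ, a₀ ≤ a → -(C * Real.exp (κ * a)) ≤ weilGroundEnergy a) :
    Summit.RiemannHypothesis :=
  riemannHypothesis_of_weilGroundEnergy_subexp H

/-- The summit is equivalent to: the ground energy is not exponentially negative at any positive
rate. [folklore] -/
theorem summit_iff_weilGroundEnergy_subexp :
    Summit.RiemannHypothesis ↔
      ∀ κ : ℝ, 0 < κ → ∃ C : ℝ, ∀ a : ℝ, 0 < a → -(C * Real.exp (κ * a)) ≤ weilGroundEnergy a :=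
  riemannHypothesis_iff_weilGroundEnergy_subexp

end Summit.RiemannHypothesis.RiemannHypothesis.Theorems
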